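import Summits.CriticalPhenomena.SAWScalingLimit.Theorems.SAWDevelopingMapInteriorFlatteningLiouvilleDefs
import Summits.CriticalPhenomena.SAWScalingLimit.Theorems.SAWDevelopingMapInteriorFlatteningOneScaleGlue
import Summits.CriticalPhenomena.SAWScalingLimit.Theorems.SAWDevelopingMapNoFoldBoundReduction

/-!
# S1 `BulkNoFold` of the line `liouville-local-limits` (crux `InteriorFlattening`, stmt-CriticalPhenomena-8297): what blocks it

Lead prover `prover-line-stmt-CriticalPhenomena-8297-c1-0`, line `liouville-local-limits`, stub S1
`stub_bulkNoFold` (`∃ k R₀ : ℝ, 0 ≤ k ∧ k < 1 ∧ RatioAtDepth R₀ k`, eventual bulk no-fold). This file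
identifies, as an EQUIVALENCE, the open input standing between the walk expansion and S1:

  **S1 ⟺ slit coherence at deep vertices** (`bulkNoFold_iff_deepSlitCoherence`).

At a vertex `v` off the root all of whose neighbours lie in the (simply connected) domain — in
particular at every `1`-deep vertex — the landed port renewal (`stub_portRenewal`), slit simple
connectivity (`stub_slitSC`) and slit source law of the `NoFoldBound` line (stmt-CriticalPhenomena-8296;
`interior_modes`) express the three modes at `v` in a positive labelling `(w₀, w₁, w₂)` through the
first-arrival sums of the slit source triples: with `c_γ = x_c^ℓ e^{-5iW(γ)/8}` the (complex) weight of a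
first arrival `γ` at the port `w_j` and `Z_γ` the returning-loop `x_c`-mass of `(Λ ∖ γ) ∖ v` between the
two other ports,

  monopole `= Σ_j S_j`,  Beltrami mode `= Σ_j ω^j B_j`,  DCS mode `= 0`,
  `S_j = Σ_γ c_γ (α_T − √3 x_c Z_γ)`,  `B_j = Σ_γ c_γ (β_T + √3 x_c Z_γ)`,

`α_T = 1 + 2x_c cos(5π/24)`, `β_T = 1 + 2x_c cos(11π/24)`. Hence `RatioAtDepth R₀ k` at an `R₀`-deep vertex
IS the slit-coherence inequality `‖Σ_j ω^j B_j‖ ≤ k ‖Σ_j S_j‖` there (`deepSlitCoherence_of_ratioAtDepth`),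
and conversely slit coherence at `R₀`-deep vertices gives `RatioAtDepth (max R₀ 1) (max k 0)`
(`ratioAtDepth_of_deepSlitCoherence`: a `1`-deep vertex is off the root with all neighbours inside; the
negative labellings carry the DCS mode, which vanishes).

So S1 is exactly the DEEP STRATUM of the registered open core `stub_slitCoherence` of the rank-2 crux
`NoFoldBound` (equivalently of `NoFoldBound` itself off the boundary collar): a bound `k < 1` needs
(i) termwise `Z_γ < (α_T − β_T)/(2√3 x_c) = sin(π/8)` for slit tips at deep vertices (the threshold of the
support item `SourceLoopBound`, stmt-CriticalPhenomena-8300) and (ii) phase coherence of the three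
first-arrival port amplitudes (no `ℤ/3`-polarisation `(1, ω², ω)`), a lower bound on the monopole against
interference of winding sheets — neither is in reach of the vertex relation (half of discrete
Cauchy–Riemann) or of the boundary sum rules (upper bounds only). Depth does not soften (i): the slit
reaches a neighbour of `v` and the returning loops live at lattice scale.

Sources: H. Duminil-Copin, S. Smirnov, Ann. of Math. 175 (2012) 1653–1665 (arXiv:1007.0575), §2 and
Lemma 1; the `NoFoldBound` line files `…NoFoldBoundInteriorModes/InteriorCore/Reduction.lean`.
Nothing unproved is asserted.
-/

noncomputable section

open scoped BigOperators
open Literature.Probability.LatticeModels Literature.Probability.RandomPlanarGeometry.SAW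

namespace Summit.CriticalPhenomena.SAWScalingLimit.Theorems.InteriorFlattening.Liouville

namespace BulkNoFold

/-- **`RatioAtDepth` gives slit coherence at deep vertices, with the same constant.** At an `R₀`-deep vertex `v ∈ Λ` off the root, in a positive labelling (`w₀ → v → w₁` turns by
`+π/3`), the inequality of `RatioAtDepth R₀ k` read through `interior_modes` (port renewal + slit simple
connectivity + slit source law, all landed for stmt-CriticalPhenomena-8296) is the slit-coherence
inequality `‖B₀ + ωB₁ + ω²B₂‖ ≤ k ‖S₀ + S₁ + S₂‖`. -/
theorem deepSlitCoherence_of_ratioAtDepth :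
    ∀ (R₀ k : ℝ), RatioAtDepth R₀ k →
    ∀ (Λ : Finset HexVertex), hexDomainSimplyConnected Λ → ∀ a ∈ hexDomainBoundary Λ, ∀ v ∈ Λ,
      Deep Λ v R₀ → v ∉ a →
      ∀ w₀ w₁ w₂ : HexVertex, hexGraph.Adj v w₀ → hexGraph.Adj v w₁ → hexGraph.Adj v w₂ →
      w₀ ≠ w₁ → w₁ ≠ w₂ → w₀ ≠ w₂ →
      winding [hexMidpoint s(w₀, v), hexCenter v, hexMidpoint s(v, w₁)] = Real.pi / 3 →
      let x : ℝ := hexCriticalFugacity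
      let α : ℝ := 1 + 2 * hexCriticalFugacity * Real.cos (5 * Real.pi / 24)
      let β : ℝ := 1 + 2 * hexCriticalFugacity * Real.cos (11 * Real.pi / 24)
      let ω : ℂ := Complex.exp (2 * Real.pi * Complex.I / 3)
      let Z : (w p q : HexVertex) → HexMidEdgeSAW Λ a s(v, w) → ℝ :=
        fun w p q (γ : HexMidEdgeSAW Λ a s(v, w)) =>
        ∑ δ : HexMidEdgeSAW ((Λ \ γ.verts.toFinset).erase v) s(v, p) s(v, q), x ^ δ.length
      let B : (w p q : HexVertex) → ℂ := fun w p q =>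
        ∑ γ : HexMidEdgeSAW Λ a s(v, w), if v ∉ γ.verts then
          γ.weight x (5 / 8) * ((β + Real.sqrt 3 * x * Z w p q γ : ℝ) : ℂ) else 0
      let S : (w p q : HexVertex) → ℂ := fun w p q =>
        ∑ γ : HexMidEdgeSAW Λ a s(v, w), if v ∉ γ.verts then
          γ.weight x (5 / 8) * ((α - Real.sqrt 3 * x * Z w p q γ : ℝ) : ℂ) else 0
      ‖B w₀ w₁ w₂ + ω * B w₁ w₂ w₀ + ω ^ 2 * B w₂ w₀ w₁‖ ≤
        k * ‖S w₀ w₁ w₂ + S w₁ w₂ w₀ + S w₂ w₀ w₁‖ := by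
  intro R₀ k hR Λ hΛ a ha v hv hdeep hva w₀ w₁ w₂ h₀ h₁ h₂ h₀₁ h₁₂ h₀₂ hchir
  dsimp only
  obtain ⟨eSum, eBelt, -⟩ :=
    Summit.CriticalPhenomena.SAWScalingLimit.Theorems.SAWDevelopingMapNoFoldBound.interior_modes
      Summit.CriticalPhenomena.SAWScalingLimit.Theorems.SAWDevelopingMapNoFoldBound.stub_portRenewal
      Summit.CriticalPhenomena.SAWScalingLimit.Theorems.SAWDevelopingMapNoFoldBound.stub_slitSC
      hΛ ha hv hva h₀ h₁ h₂ h₀₁ h₁₂ h₀₂ hchir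
  have H1 : ‖hexParafermionicObservable Λ a hexCriticalFugacity (5 / 8) s(v, w₀) +
        Complex.exp (2 * Real.pi * Complex.I / 3) *
          hexParafermionicObservable Λ a hexCriticalFugacity (5 / 8) s(v, w₁) +
        Complex.exp (2 * Real.pi * Complex.I / 3) ^ 2 *
          hexParafermionicObservable Λ a hexCriticalFugacity (5 / 8) s(v, w₂)‖ ≤
      k * ‖hexParafermionicObservable Λ a hexCriticalFugacity (5 / 8) s(v, w₀) +
        hexParafermionicObservable Λ a hexCriticalFugacity (5 / 8) s(v, w₁) +
        hexParafermionicObservable Λ a hexCriticalFugacity (5 / 8) s(v, w₂)‖ :=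
    hR Λ hΛ a ha v hv hdeep w₀ w₁ w₂ h₀ h₁ h₂ h₀₁ h₁₂ h₀₂
  rw [eBelt, eSum] at H1
  exact H1

/-- A `1`-deep vertex has all its neighbours in the domain. -/
theorem nbr_mem_of_deep_one {Λ : Finset HexVertex} {v : HexVertex} {R : ℝ} (hdeep : Deep Λ v R)
    (hR : 1 ≤ R) {u : HexVertex} (hu : hexGraph.Adj v u) : u ∈ Λ :=
  hdeep u ((OneMouth.dist_le_one_of_adj hu).trans hR)

/-- A `1`-deep vertex is off every boundary root (registered sub-goal: the depth hypothesis of S1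
subsumes the two side conditions `v ∉ a`, "all neighbours inside" of the interior stratum of (K)). -/
theorem not_mem_root_of_deep_one :
    ∀ (Λ : Finset HexVertex) (v : HexVertex) (R : ℝ), v ∈ Λ → Deep Λ v R → 1 ≤ R →
      ∀ a ∈ hexDomainBoundary Λ, v ∉ a := by
  intro Λ v R hv hdeep hR a ha
  obtain ⟨hae, u, c₀, rfl, hc₀, hu⟩ := ha
  have huc : hexGraph.Adj u c₀ := by simpa using hae
  intro hva
  rcases Sym2.mem_iff.1 hva with rfl | rfl
  · exact hu hv
  · exact hu (nbr_mem_of_deep_one hdeep hR huc.symm)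

/-- **Slit coherence at `R₀`-deep vertices gives `RatioAtDepth (max R₀ 1) (max k 0)`.** A
`max R₀ 1`-deep vertex is `R₀`-deep, off the root, with all neighbours inside; a labelling is positive
or negative (`stub_localTurns`): in the positive case `interior_modes` turns the slit-coherence
inequality into the no-fold inequality, in the negative case the `ω`-combination is the DCS mode of the
transposed (positive) labelling and vanishes. -/
theorem ratioAtDepth_of_deepSlitCoherence {R₀ k : ℝ}
    (hC : ∀ (Λ : Finset HexVertex), hexDomainSimplyConnected Λ → ∀ a ∈ hexDomainBoundary Λ, ∀ v ∈ Λ,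
      Deep Λ v R₀ → v ∉ a →
      ∀ w₀ w₁ w₂ : HexVertex, hexGraph.Adj v w₀ → hexGraph.Adj v w₁ → hexGraph.Adj v w₂ →
      w₀ ≠ w₁ → w₁ ≠ w₂ → w₀ ≠ w₂ →
      winding [hexMidpoint s(w₀, v), hexCenter v, hexMidpoint s(v, w₁)] = Real.pi / 3 →
      let x : ℝ := hexCriticalFugacity
      let α : ℝ := 1 + 2 * hexCriticalFugacity * Real.cos (5 * Real.pi / 24)
      let β : ℝ := 1 + 2 * hexCriticalFugacity * Real.cos (11 * Real.pi / 24)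
      let ω : ℂ := Complex.exp (2 * Real.pi * Complex.I / 3)
      let Z : (w p q : HexVertex) → HexMidEdgeSAW Λ a s(v, w) → ℝ :=
        fun w p q (γ : HexMidEdgeSAW Λ a s(v, w)) =>
        ∑ δ : HexMidEdgeSAW ((Λ \ γ.verts.toFinset).erase v) s(v, p) s(v, q), x ^ δ.length
      let B : (w p q : HexVertex) → ℂ := fun w p q =>
        ∑ γ : HexMidEdgeSAW Λ a s(v, w), if v ∉ γ.verts then
          γ.weight x (5 / 8) * ((β + Real.sqrt 3 * x * Z w p q γ : ℝ) : ℂ) else 0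
      let S : (w p q : HexVertex) → ℂ := fun w p q =>
        ∑ γ : HexMidEdgeSAW Λ a s(v, w), if v ∉ γ.verts then
          γ.weight x (5 / 8) * ((α - Real.sqrt 3 * x * Z w p q γ : ℝ) : ℂ) else 0
      ‖B w₀ w₁ w₂ + ω * B w₁ w₂ w₀ + ω ^ 2 * B w₂ w₀ w₁‖ ≤
        k * ‖S w₀ w₁ w₂ + S w₁ w₂ w₀ + S w₂ w₀ w₁‖) :
    RatioAtDepth (max R₀ 1) (max k 0) := by
  intro Λ hΛ a ha v hv hdeep w₀ w₁ w₂ h₀ h₁ h₂ h₀₁ h₁₂ h₀₂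
  have h1 : (1 : ℝ) ≤ max R₀ 1 := le_max_right _ _
  have hdeep₀ : Deep Λ v R₀ := fun w hw => hdeep w (hw.trans (le_max_left _ _))
  have hva : v ∉ a := not_mem_root_of_deep_one Λ v _ hv hdeep h1 a ha
  -- the goal, spelled over the raw observable
  change ‖hexParafermionicObservable Λ a hexCriticalFugacity (5 / 8) s(v, w₀) +
        Complex.exp (2 * Real.pi * Complex.I / 3) *
          hexParafermionicObservable Λ a hexCriticalFugacity (5 / 8) s(v, w₁) +
        Complex.exp (2 * Real.pi * Complex.I / 3) ^ 2 *
          hexParafermionicObservable Λ a hexCriticalFugacity (5 / 8) s(v, w₂)‖ ≤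
      max k 0 * ‖hexParafermionicObservable Λ a hexCriticalFugacity (5 / 8) s(v, w₀) +
        hexParafermionicObservable Λ a hexCriticalFugacity (5 / 8) s(v, w₁) +
        hexParafermionicObservable Λ a hexCriticalFugacity (5 / 8) s(v, w₂)‖
  obtain ⟨ε, hε, T01, -, -, -, -, T02⟩ :=
    Summit.CriticalPhenomena.SAWScalingLimit.Theorems.SAWDevelopingMapNoFoldBound.stub_localTurns
      v w₀ w₁ w₂ h₀ h₁ h₂ h₀₁ h₁₂ h₀₂
  rcases hε with rfl | rfl
  · -- positive labelling: slit coherence through `interior_modes`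
    have hchir : winding [hexMidpoint s(w₀, v), hexCenter v, hexMidpoint s(v, w₁)] = Real.pi / 3 := by
      rw [T01]; ring
    have HC := hC Λ hΛ a ha v hv hdeep₀ hva w₀ w₁ w₂ h₀ h₁ h₂ h₀₁ h₁₂ h₀₂ hchir
    dsimp only at HC
    obtain ⟨eSum, eBelt, -⟩ :=
      Summit.CriticalPhenomena.SAWScalingLimit.Theorems.SAWDevelopingMapNoFoldBound.interior_modes
        Summit.CriticalPhenomena.SAWScalingLimit.Theorems.SAWDevelopingMapNoFoldBound.stub_portRenewal
        Summit.CriticalPhenomena.SAWScalingLimit.Theorems.SAWDevelopingMapNoFoldBound.stub_slitSC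
        hΛ ha hv hva h₀ h₁ h₂ h₀₁ h₁₂ h₀₂ hchir
    rw [eBelt, eSum]
    exact HC.trans (mul_le_mul_of_nonneg_right (le_max_left _ _) (norm_nonneg _))
  · -- negative labelling: `(w₀, w₂, w₁)` is positive and our combination is its DCS mode
    have hchir : winding [hexMidpoint s(w₀, v), hexCenter v, hexMidpoint s(v, w₂)] = Real.pi / 3 := by
      rw [T02]; ring
    obtain ⟨-, -, eDCS⟩ :=
      Summit.CriticalPhenomena.SAWScalingLimit.Theorems.SAWDevelopingMapNoFoldBound.interior_modes
        Summit.CriticalPhenomena.SAWScalingLimit.Theorems.SAWDevelopingMapNoFoldBound.stub_portRenewal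
        Summit.CriticalPhenomena.SAWScalingLimit.Theorems.SAWDevelopingMapNoFoldBound.stub_slitSC
        hΛ ha hv hva h₀ h₂ h₁ h₀₂ h₁₂.symm h₀₁ hchir
    rw [eDCS, norm_zero]
    exact mul_nonneg (le_max_right _ _) (norm_nonneg _)

/-- **S1 ⟺ slit coherence at deep vertices.** Eventual bulk no-fold is EQUIVALENT to the
slit-coherence inequality of the `NoFoldBound` line (registered open core `stub_slitCoherence` of
stmt-CriticalPhenomena-8296) restricted to `R₀`-deep vertices, for some `k < 1` and some depth `R₀`:
this is precisely the open input S1 waits for (the deep stratum of (K)). -/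
theorem bulkNoFold_iff_deepSlitCoherence :
    (∃ k R₀ : ℝ, 0 ≤ k ∧ k < 1 ∧ RatioAtDepth R₀ k) ↔
    ∃ k R₀ : ℝ, k < 1 ∧
    ∀ (Λ : Finset HexVertex), hexDomainSimplyConnected Λ → ∀ a ∈ hexDomainBoundary Λ, ∀ v ∈ Λ,
      Deep Λ v R₀ → v ∉ a →
      ∀ w₀ w₁ w₂ : HexVertex, hexGraph.Adj v w₀ → hexGraph.Adj v w₁ → hexGraph.Adj v w₂ →
      w₀ ≠ w₁ → w₁ ≠ w₂ → w₀ ≠ w₂ →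
      winding [hexMidpoint s(w₀, v), hexCenter v, hexMidpoint s(v, w₁)] = Real.pi / 3 →
      let x : ℝ := hexCriticalFugacity
      let α : ℝ := 1 + 2 * hexCriticalFugacity * Real.cos (5 * Real.pi / 24)
      let β : ℝ := 1 + 2 * hexCriticalFugacity * Real.cos (11 * Real.pi / 24)
      let ω : ℂ := Complex.exp (2 * Real.pi * Complex.I / 3)
      let Z : (w p q : HexVertex) → HexMidEdgeSAW Λ a s(v, w) → ℝ :=
        fun w p q (γ : HexMidEdgeSAW Λ a s(v, w)) =>
        ∑ δ : HexMidEdgeSAW ((Λ \ γ.verts.toFinset).erase v) s(v, p) s(v, q), x ^ δ.length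
      let B : (w p q : HexVertex) → ℂ := fun w p q =>
        ∑ γ : HexMidEdgeSAW Λ a s(v, w), if v ∉ γ.verts then
          γ.weight x (5 / 8) * ((β + Real.sqrt 3 * x * Z w p q γ : ℝ) : ℂ) else 0
      let S : (w p q : HexVertex) → ℂ := fun w p q =>
        ∑ γ : HexMidEdgeSAW Λ a s(v, w), if v ∉ γ.verts then
          γ.weight x (5 / 8) * ((α - Real.sqrt 3 * x * Z w p q γ : ℝ) : ℂ) else 0
      ‖B w₀ w₁ w₂ + ω * B w₁ w₂ w₀ + ω ^ 2 * B w₂ w₀ w₁‖ ≤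
        k * ‖S w₀ w₁ w₂ + S w₁ w₂ w₀ + S w₂ w₀ w₁‖ := by
  constructor
  · rintro ⟨k, R₀, -, hk1, hR⟩
    exact ⟨k, R₀, hk1, deepSlitCoherence_of_ratioAtDepth R₀ k hR⟩
  · rintro ⟨k, R₀, hk1, hC⟩
    exact ⟨max k 0, max R₀ 1, le_max_right _ _, max_lt hk1 one_pos, ratioAtDepth_of_deepSlitCoherence hC⟩

end BulkNoFold

end Summit.CriticalPhenomena.SAWScalingLimit.Theorems.InteriorFlattening.Liouville

end
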